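import Mathlib.Algebra.Order.BigOperators.Group.Finset
import Mathlib.Algebra.Order.BigOperators.Group.Multiset
import Mathlib.Algebra.BigOperators.Ring.Finset
import Mathlib.Algebra.BigOperators.Field
import Mathlib.Data.Real.Basic
import Mathlib.Algebra.Ring.Parity
import Mathlib.Tactic.Linarith
import Mathlib.Tactic.Positivity
import Mathlib.Tactic.Ring
import Mathlib.Tactic.NormNum
import Mathlib.Tactic.FieldSimp
import HarnessLib

/-!
# From a one-level density to a non-vanishing proportion (the Iwaniec–Luo–Sarnak conversion)

Topic `Literature/NumberTheory/LFunctions` (namespace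
`Literature.NumberTheory.LFunctions.OneLevelDensityToNonvanishing`). PROVED, elementary; NO named
fact is introduced (D-0026). Written for the cell `landau-siegel` (rung F-S3, sub-cell §C, reader r7 = the
FAMILY route), OFFER #2 of 2026-08-27 (proof-kind, 0 facts).

## What the source prints (held text, read 2026-08-27)

V. Chandee, X. Li, M. B. Milinovich, *One-level densities of large even and odd orthogonal families of
automorphic `L`-functions*, arXiv:2605.17012 (2026), §10 «Proof of Corollary 1.2»
[held `paper:arxiv-2605.17012`, p0017:L40–L75 and p0017:L111–p0018] — the argument of Iwaniec–Luo–Sarnak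
(Publ. IHES 91 (2000)) in the sign-separated, level-averaged setting. For a non-negative even test function
`Φ` and a weighted family of `L`-functions with (GRH) real scaled ordinates `γ_f`:

* positivity: `𝒪ℒ^±(Q) = (1/N^±) Σ_q Ψ(q/Q) Σ_f Σ_{γ_f} Φ(γ_f log Q/2π) ≥ (1/N^±) Σ_q Ψ Σ_f Φ(0)·ord_{s=½} L(s,f)`
  «where (by positivity) the inequality follows from considering only the contribution of the zeros at the
  central point … and discarding all other terms in the sum over zeros» (p0017:L41–L51);
* hence, from the density asymptotics, `limsup Σ_m m·P_m^+(Q) ≤ g⁺` and `limsup Σ_m m·P_m^-(Q) ≤ 1 + g⁻`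
  (p0017:L100–L110), `P_m^±` = the weighted proportion of forms with `ord = m`;
* parity: in the even class `ord` is even, so `1 = P₀⁺ + Σ_{m≥2} P_m⁺ ≤ P₀⁺ + ½ Σ m P_m⁺ ≤ P₀⁺ + ½g⁺ + ε`,
  i.e. `P₀⁺ ≥ 1 − ½ g⁺ − ε`; in the odd class `ord` is odd, so
  `1 ≤ P₁⁻ + ⅓ Σ_{m≥3} m P_m⁻ ≤ ⅔ P₁⁻ + ⅓(1 + g⁻) + ε`, i.e. `P₁⁻ ≥ 1 − ½ g⁻ − ε` (p0017:L111–p0018).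

## What is typed here (every finite weighted family; no `L`-functions, no limits)

* `centralMultiplicity_mul_le_zeroSum` — the POSITIVITY step for one member: for a finite multiset `Z` of
  REAL numbers (the scaled ordinates; under GRH they are real) and `φ ≥ 0` on `ℝ`,
  `(count of 0 in Z) · φ 0 ≤ Σ_{γ ∈ Z} φ γ`. Its only analytic content is «`γ` real and `φ ≥ 0`» — this is
  the place where GRH enters every «density ⇒ non-vanishing» corollary (the CURRENCY SPLIT of the cell's
  literature synthesis: the density asymptotic itself may be unconditional, the conversion is not).
* `weightedOrder_le_of_density` — pointwise `ordᵢ · φ₀ ≤ Dᵢ`, weights `w ≥ 0`, `Σ w D ≤ A · Σ w`, `φ₀ > 0`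
  ⇒ `Σ w · ord ≤ (A/φ₀) · Σ w`.
* `nonvanishingMass_ge` (Markov): `ord : ι → ℕ`, `Σ w · ord ≤ g · W` ⇒ `mass{ord = 0} ≥ (1 − g) · W`.
* `nonvanishingMass_ge_of_even` (SO(even) class): all `ordᵢ` even ⇒ `mass{ord = 0} ≥ (1 − g/2) · W`.
* `ordOneMass_ge_of_odd` (SO(odd) class): all `ordᵢ` odd and `Σ w · ord ≤ (1 + g) · W`
  ⇒ `mass{ord = 1} ≥ (1 − g/2) · W`.

With CLM26 Thm 1.1 (`g⁺ = 0.6036…`, `1 + g⁻`) these give Cor 1.2's `0.698…` and `0.978…`; with ILS's support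
`(−2,2)` they give the classical `9/16` (even) and `15/16` (odd); with a unitary density `W = 1` and support
`8/3` (Paul 2025) `5/8`. WHAT THIS IS NOT: no statement about any family of `L`-functions, about GRH, or
about Landau–Siegel zeros; the density facts are typed elsewhere (cell rows T-019, T-233…T-235, T-448/449).

## References

* [ChandeeLiMilinovich2026] §10, proof of Corollary 1.2 (held `paper:arxiv-2605.17012` p0017–p0018).
* H. Iwaniec, W. Luo, P. Sarnak, *Low lying zeros of families of `L`-functions*, Publ. Math. IHES 91 (2000)
  55–131, (1.41)–(1.48) (the original argument; not held as text).
-/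

namespace Literature.NumberTheory.LFunctions.OneLevelDensityToNonvanishing

open Finset

variable {ι : Type*}

/-! ### The positivity step (one member of the family) -/

/-- **Positivity step of the ILS conversion.** For a finite multiset `Z` of real «scaled ordinates» and a
test function `φ` that is non-negative on `ℝ`, the multiplicity of `0` in `Z` times `φ 0` is at most the
one-level sum `Σ_{γ ∈ Z} φ γ` — «by positivity … considering only the contribution of the zeros at the
central point and discarding all other terms». The hypotheses «`Z ⊂ ℝ`» (GRH for the member) and «`φ ≥ 0`»
are exactly what the step uses. [cite: ChandeeLiMilinovich2026, §10 proof of Cor. 1.2 (p0017:L41–L51)] -/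
theorem centralMultiplicity_mul_le_zeroSum (Z : Multiset ℝ) (φ : ℝ → ℝ) (hφ : ∀ x, 0 ≤ φ x) :
    (Z.count 0 : ℝ) * φ 0 ≤ (Z.map φ).sum := by
  induction Z using Multiset.induction with
  | empty => simp
  | cons a Z ih =>
      rw [Multiset.count_cons, Multiset.map_cons, Multiset.sum_cons]
      by_cases ha : 0 = a
      · subst ha
        simp only [if_true, Nat.cast_add, Nat.cast_one]
        linarith
      · rw [if_neg ha]
        simp only [add_zero]
        linarith [hφ a]

/-! ### From the averaged density to the averaged order of vanishing -/

/-- **Averaged order of vanishing from an averaged density.** If pointwise `ordᵢ · φ₀ ≤ Dᵢ` (the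
positivity step, member by member), the weights are non-negative, `φ₀ > 0`, and the weighted density
satisfies `Σ wᵢ Dᵢ ≤ A · Σ wᵢ`, then `Σ wᵢ ordᵢ ≤ (A / φ₀) · Σ wᵢ`.
[cite: ChandeeLiMilinovich2026, §10 displays (10.3)–(10.4) (p0017:L64–L75, L100–L110)] -/
theorem weightedOrder_le_of_density (s : Finset ι) (w D : ι → ℝ) (ord : ι → ℕ) (φ₀ A : ℝ)
    (hφ₀ : 0 < φ₀) (hw : ∀ i ∈ s, 0 ≤ w i) (hpos : ∀ i ∈ s, (ord i : ℝ) * φ₀ ≤ D i)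
    (hdens : ∑ i ∈ s, w i * D i ≤ A * ∑ i ∈ s, w i) :
    ∑ i ∈ s, w i * (ord i : ℝ) ≤ A / φ₀ * ∑ i ∈ s, w i := by
  have h1 : (∑ i ∈ s, w i * (ord i : ℝ)) * φ₀ ≤ ∑ i ∈ s, w i * D i := by
    rw [Finset.sum_mul]
    refine Finset.sum_le_sum fun i hi => ?_
    have := mul_le_mul_of_nonneg_left (hpos i hi) (hw i hi)
    linarith [this]
  rw [div_mul_eq_mul_div, le_div_iff₀ hφ₀]
  exact h1.trans hdens

/-! ### Markov and parity -/

/-- **Markov step (no parity information).** For weights `w ≥ 0` and orders `ord : ι → ℕ` with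
`Σ wᵢ ordᵢ ≤ g · W` (`W = Σ wᵢ`), the `w`-mass of `{ord = 0}` is at least `(1 − g) · W`.
[cite: ChandeeLiMilinovich2026, §10 (p0017:L76–L110)] -/
theorem nonvanishingMass_ge (s : Finset ι) (w : ι → ℝ) (ord : ι → ℕ) (g : ℝ)
    (hw : ∀ i ∈ s, 0 ≤ w i) (hord : ∑ i ∈ s, w i * (ord i : ℝ) ≤ g * ∑ i ∈ s, w i) :
    (1 - g) * ∑ i ∈ s, w i ≤ ∑ i ∈ s with ord i = 0, w i := by
  -- pointwise: `w · 1{ord = 0} ≥ w · (1 − ord)`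
  have key : ∑ i ∈ s, w i - ∑ i ∈ s, w i * (ord i : ℝ) ≤ ∑ i ∈ s with ord i = 0, w i := by
    rw [Finset.sum_filter, ← Finset.sum_sub_distrib]
    refine Finset.sum_le_sum fun i hi => ?_
    by_cases h : ord i = 0
    · simp [h]
    · rw [if_neg h]
      have h1 : (1 : ℝ) ≤ (ord i : ℝ) := by exact_mod_cast Nat.one_le_iff_ne_zero.2 h
      nlinarith [hw i hi]
  nlinarith [key, hord]

/-- **SO(even) class: parity doubles the saving.** If every `ordᵢ` is EVEN (root number `+1`), then
`Σ wᵢ ordᵢ ≤ g · W` gives `mass{ord = 0} ≥ (1 − g/2) · W` — «`1 = P₀⁺ + Σ_{m≥1} P_m⁺ ≤ P₀⁺ + ½ Σ_{m≥2} m P_m⁺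
≤ P₀⁺ + ½ g⁺ + ε`». [cite: ChandeeLiMilinovich2026, §10 (p0017:L111–L118)] -/
theorem nonvanishingMass_ge_of_even (s : Finset ι) (w : ι → ℝ) (ord : ι → ℕ) (g : ℝ)
    (hw : ∀ i ∈ s, 0 ≤ w i) (heven : ∀ i ∈ s, Even (ord i))
    (hord : ∑ i ∈ s, w i * (ord i : ℝ) ≤ g * ∑ i ∈ s, w i) :
    (1 - g / 2) * ∑ i ∈ s, w i ≤ ∑ i ∈ s with ord i = 0, w i := by
  -- pointwise: for even `ord`, `1{ord = 0} ≥ 1 − ord/2`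
  have key : ∑ i ∈ s, w i - (∑ i ∈ s, w i * (ord i : ℝ)) / 2 ≤ ∑ i ∈ s with ord i = 0, w i := by
    rw [Finset.sum_filter, Finset.sum_div, ← Finset.sum_sub_distrib]
    refine Finset.sum_le_sum fun i hi => ?_
    by_cases h : ord i = 0
    · simp [h]
    · rw [if_neg h]
      obtain ⟨r, hr⟩ := heven i hi
      have hr1 : 1 ≤ r := by
        rcases Nat.eq_zero_or_pos r with h0 | h0
        · exact absurd (by simpa [h0] using hr) h
        · exact h0
      have h2 : (2 : ℝ) ≤ (ord i : ℝ) := by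
        have : 2 ≤ ord i := by omega
        exact_mod_cast this
      nlinarith [hw i hi]
  nlinarith [key, hord]

/-- **SO(odd) class.** If every `ordᵢ` is ODD (root number `−1`, so `L(½) = 0` always) and
`Σ wᵢ ordᵢ ≤ (1 + g) · W` (the odd density carries the extra `Φ(0)`), then the `w`-mass of
`{ord = 1}` — the forms with `L′(½) ≠ 0` — is at least `(1 − g/2) · W`: «`1 = Σ P_m⁻ ≤ P₁⁻ + ⅓ Σ_{m≥3} m P_m⁻
≤ ⅔ P₁⁻ + ⅓ (1 + g⁻) + ε`». [cite: ChandeeLiMilinovich2026, §10 (p0017:L119–p0018)] -/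
theorem ordOneMass_ge_of_odd (s : Finset ι) (w : ι → ℝ) (ord : ι → ℕ) (g : ℝ)
    (hw : ∀ i ∈ s, 0 ≤ w i) (hodd : ∀ i ∈ s, Odd (ord i))
    (hord : ∑ i ∈ s, w i * (ord i : ℝ) ≤ (1 + g) * ∑ i ∈ s, w i) :
    (1 - g / 2) * ∑ i ∈ s, w i ≤ ∑ i ∈ s with ord i = 1, w i := by
  -- pointwise: for odd `ord`, `1{ord = 1} ≥ (3 − ord)/2`
  have key : (3 * ∑ i ∈ s, w i - ∑ i ∈ s, w i * (ord i : ℝ)) / 2 ≤ ∑ i ∈ s with ord i = 1, w i := by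
    rw [Finset.sum_filter, Finset.mul_sum, ← Finset.sum_sub_distrib, Finset.sum_div]
    refine Finset.sum_le_sum fun i hi => ?_
    by_cases h : ord i = 1
    · simp [h]; linarith [hw i hi]
    · rw [if_neg h]
      obtain ⟨r, hr⟩ := hodd i hi
      have hr1 : 1 ≤ r := by
        rcases Nat.eq_zero_or_pos r with h0 | h0
        · exact absurd (by simpa [h0] using hr) h
        · exact h0
      have h3 : (3 : ℝ) ≤ (ord i : ℝ) := by
        have : 3 ≤ ord i := by omega
        exact_mod_cast this
      nlinarith [hw i hi]
  nlinarith [key, hord]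

/-- **The conversion end to end (even class).** Pointwise positivity `ordᵢ · φ₀ ≤ Dᵢ`, weights `w ≥ 0`,
all `ordᵢ` even, `φ₀ > 0`, and a weighted density bound `Σ w D ≤ A · Σ w` give
`mass{ord = 0} ≥ (1 − A/(2φ₀)) · Σ w` — with `φ₀ = Φ(0) = 1` and `A = g⁺` this is CLM26's
`P₀⁺ ≥ 1 − ½ g⁺`. [cite: ChandeeLiMilinovich2026, §10 proof of Cor. 1.2] -/
theorem nonvanishingMass_ge_of_density_even (s : Finset ι) (w D : ι → ℝ) (ord : ι → ℕ) (φ₀ A : ℝ)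
    (hφ₀ : 0 < φ₀) (hw : ∀ i ∈ s, 0 ≤ w i) (heven : ∀ i ∈ s, Even (ord i))
    (hpos : ∀ i ∈ s, (ord i : ℝ) * φ₀ ≤ D i) (hdens : ∑ i ∈ s, w i * D i ≤ A * ∑ i ∈ s, w i) :
    (1 - A / φ₀ / 2) * ∑ i ∈ s, w i ≤ ∑ i ∈ s with ord i = 0, w i :=
  nonvanishingMass_ge_of_even s w ord (A / φ₀) hw heven
    (weightedOrder_le_of_density s w D ord φ₀ A hφ₀ hw hpos hdens)

/-- **Worked constants** (sanity checks of the printed numbers' shape): ILS support `(−2,2)`, even class,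
`g = 7/8` … here only the arithmetic `1 − (7/8)/2 = 9/16` and the naive CLM pair `1 − (11/18)/2 = 25/36`,
`1 − (1/18)/2 = 35/36` (p0004:L31–L37). [cite: ChandeeLiMilinovich2026, §1.1 (p0004:L31–L37)] -/
theorem worked_constants :
    (1 : ℝ) - (7 / 8) / 2 = 9 / 16 ∧ (1 : ℝ) - (11 / 18) / 2 = 25 / 36 ∧ (1 : ℝ) - (1 / 18) / 2 = 35 / 36 := by
  norm_num

end Literature.NumberTheory.LFunctions.OneLevelDensityToNonvanishing
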